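import Mathlib.Analysis.InnerProductSpace.Adjoint
import HarnessLib

/-!
# K1L_D `LagrangianRenormalisationStepDesign` (stmt-AnomalousDissipation-27980), line «onelevel-design», stub `stub_oneLevelL_IW`:
# the WINDOW LEDGER — an abstract duality bookkeeping lemma for perturbed contraction sequences (helper; `--supports … --as helper`)

Pure Hilbert-space algebra, no PDE.  It is the keystone of the lead's architecture ARCH-ABT for the one-level comparison
`(1 − C₁ρ^{σ₁})·drop v ≤ drop u` (lead-k1l-onelevel-p1 g2, finding F-lead-2, 2026-08-28): the refresh windows of level `m+1` give a
sequence of linear contractions `T k` (the level-`m` solution maps over the windows, frame change included) on `V = L²_σ(𝕋³)`; the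
homogenised problem follows them exactly, `v (k+1) = T k (v k)`, while the slow part of the level-`(m+1)` solution follows them up to
per-window errors, `u (k+1) = T k (u k) + e k`.  If every error is DISSIPATION-DOMINATED,
`|⟪y, e k⟫| ≤ η · √(‖u k‖² − ‖T k (u k)‖²) · √(‖y‖² − ‖(T k)† y‖²)` for all `y` (the error pairs with a test vector only through the
energy the test vector loses under the ADJOINT window map), then after any number `K` of windows
`‖u K‖² ≤ ‖v K‖² + 3η · (‖w₀‖² − ‖v K‖²)` (`0 ≤ η ≤ 1/8`): the excess energy of `u` is DECAY-RELATIVE — bounded by `η` times the energy `v`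
has actually dropped — with NO a-priori lower bound on that drop and NO dependence on `K` (the number of refresh windows in `[0, t]` is
astronomically large, so any per-window triangle inequality is useless).  Proof: the duality identity
`⟪z, u K − v K⟫ = Σ_{k<K} ⟪(T (k+1))† ⋯ (T (K−1))† z, e k⟫`, ONE Cauchy–Schwarz over `k` (done inductively, peeling the last window), and
`‖z‖² − ‖(T 0)† ⋯ (T (K−1))† z‖² ≤ ‖w₀‖² − ‖v K‖²` at `z = v K` (because `⟪(T 0)†⋯(T (K−1))† v K, w₀⟫ = ‖v K‖²`).
Why this shape (F-lead-2): per-window errors of shape `η·(decay in the window)·amplitude` (the (V) rate error, the burst term, the sector-diagonal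
leak, the distortion AS A RATE ERROR) are exactly the dissipation-dominated ones; errors of shape `η·√decay·amplitude` (what a per-window forced
ENERGY estimate gives) or `θ·amplitude` (kinematic frame terms) are not, and their coherent accumulation over the windows is not decay-relative.
Infrastructure for rung F-D1.A0; NOT a proof of the crux, of Onsager's conjecture or of anomalous dissipation.
-/

set_option linter.dupNamespace false

namespace Summit.AnomalousDissipation.AnomalousDissipation.Theorems.SolenoidalFractalHomogenisation.LagrangianStep

open scoped InnerProductSpace
open ContinuousLinearMap

noncomputable section

variable {V : Type*} [NormedAddCommGroup V] [InnerProductSpace ℝ V] [CompleteSpace V]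

/-! ## Elementary facts about a contraction and its adjoint -/

/-- A pointwise contraction has a contracting adjoint: `‖T† y‖ ≤ ‖y‖`. -/
theorem norm_adjoint_apply_le_of_contraction {T : V →L[ℝ] V} (hT : ∀ x, ‖T x‖ ≤ ‖x‖) (y : V) :
    ‖adjoint T y‖ ≤ ‖y‖ := by
  have h1 : ‖adjoint T y‖ ^ 2 = ⟪y, T (adjoint T y)⟫_ℝ := by
    rw [← real_inner_self_eq_norm_sq, adjoint_inner_left]
  have h2 : ⟪y, T (adjoint T y)⟫_ℝ ≤ ‖y‖ * ‖T (adjoint T y)‖ := real_inner_le_norm _ _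
  have h3 : ‖y‖ * ‖T (adjoint T y)‖ ≤ ‖adjoint T y‖ * ‖y‖ := by
    rw [mul_comm]; exact mul_le_mul_of_nonneg_right (hT _) (norm_nonneg _)
  have h4 : ‖adjoint T y‖ ^ 2 ≤ ‖adjoint T y‖ * ‖y‖ := by linarith
  by_cases h0 : ‖adjoint T y‖ = 0
  · rw [h0]; exact norm_nonneg _
  · have hpos : 0 < ‖adjoint T y‖ := lt_of_le_of_ne (norm_nonneg _) (Ne.symm h0)
    nlinarith

omit [CompleteSpace V] in
/-- The DISSIPATION of `x` under `T`, `‖x‖² − ‖T x‖²`, is nonnegative for a contraction. -/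
theorem dissip_nonneg {T : V →L[ℝ] V} (hT : ∀ x, ‖T x‖ ≤ ‖x‖) (x : V) : 0 ≤ ‖x‖ ^ 2 - ‖T x‖ ^ 2 := by
  have := hT x
  nlinarith [norm_nonneg (T x), norm_nonneg x]

/-- The adjoint dissipation `‖y‖² − ‖T† y‖²` is nonnegative for a contraction. -/
theorem dissipAdj_nonneg {T : V →L[ℝ] V} (hT : ∀ x, ‖T x‖ ≤ ‖x‖) (y : V) : 0 ≤ ‖y‖ ^ 2 - ‖adjoint T y‖ ^ 2 := by
  have := norm_adjoint_apply_le_of_contraction hT y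
  nlinarith [norm_nonneg (adjoint T y), norm_nonneg y]

/-- KEY OPERATOR INEQUALITY: the adjoint dissipation of `T x` is at most the dissipation of `x`,
`‖T x‖² − ‖T† (T x)‖² ≤ ‖x‖² − ‖T x‖²` — i.e. `0 ≤ ‖x − T†T x‖²`; no spectral theorem needed. -/
theorem dissipAdj_apply_le_dissip (T : V →L[ℝ] V) (x : V) :
    ‖T x‖ ^ 2 - ‖adjoint T (T x)‖ ^ 2 ≤ ‖x‖ ^ 2 - ‖T x‖ ^ 2 := by
  have h0 : 0 ≤ ‖x - adjoint T (T x)‖ ^ 2 := by positivity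
  have h1 : ‖x - adjoint T (T x)‖ ^ 2 = ‖x‖ ^ 2 - 2 * ⟪x, adjoint T (T x)⟫_ℝ + ‖adjoint T (T x)‖ ^ 2 :=
    norm_sub_sq_real _ _
  have h2 : ⟪x, adjoint T (T x)⟫_ℝ = ‖T x‖ ^ 2 := by
    rw [adjoint_inner_right, real_inner_self_eq_norm_sq]
  linarith

/-! ## Consequences of the dissipation-dominated error hypothesis for ONE window -/

/-- Under the dissipation-dominated hypothesis the error itself is small in norm: `‖e‖ ≤ η √(dissipation of u)`. -/
theorem norm_err_le {T : V →L[ℝ] V} {u e : V} {η : ℝ} (hη : 0 ≤ η)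
    (hDD : ∀ y : V, |⟪y, e⟫_ℝ| ≤ η * Real.sqrt (‖u‖ ^ 2 - ‖T u‖ ^ 2) * Real.sqrt (‖y‖ ^ 2 - ‖adjoint T y‖ ^ 2)) :
    ‖e‖ ≤ η * Real.sqrt (‖u‖ ^ 2 - ‖T u‖ ^ 2) := by
  have h := hDD e
  have h1 : |⟪e, e⟫_ℝ| = ‖e‖ ^ 2 := by
    rw [real_inner_self_eq_norm_sq, abs_of_nonneg (by positivity)]
  have h2 : Real.sqrt (‖e‖ ^ 2 - ‖adjoint T e‖ ^ 2) ≤ ‖e‖ := by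
    calc Real.sqrt (‖e‖ ^ 2 - ‖adjoint T e‖ ^ 2) ≤ Real.sqrt (‖e‖ ^ 2) :=
          Real.sqrt_le_sqrt (by nlinarith [norm_nonneg (adjoint T e)])
      _ = ‖e‖ := Real.sqrt_sq (norm_nonneg _)
  have hA : 0 ≤ η * Real.sqrt (‖u‖ ^ 2 - ‖T u‖ ^ 2) := mul_nonneg hη (Real.sqrt_nonneg _)
  have h3 : ‖e‖ ^ 2 ≤ η * Real.sqrt (‖u‖ ^ 2 - ‖T u‖ ^ 2) * ‖e‖ := by
    calc ‖e‖ ^ 2 = |⟪e, e⟫_ℝ| := h1.symm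
      _ ≤ η * Real.sqrt (‖u‖ ^ 2 - ‖T u‖ ^ 2) * Real.sqrt (‖e‖ ^ 2 - ‖adjoint T e‖ ^ 2) := h
      _ ≤ η * Real.sqrt (‖u‖ ^ 2 - ‖T u‖ ^ 2) * ‖e‖ := mul_le_mul_of_nonneg_left h2 hA
  by_cases h0 : ‖e‖ = 0
  · rw [h0]; exact hA
  · have hpos : 0 < ‖e‖ := lt_of_le_of_ne (norm_nonneg _) (Ne.symm h0)
    nlinarith

/-- The error's correlation with the propagated state is decay-linear: `⟪T u, e⟫ ≤ η · (‖u‖² − ‖T u‖²)`. -/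
theorem inner_apply_err_le {T : V →L[ℝ] V} (hT : ∀ x, ‖T x‖ ≤ ‖x‖) {u e : V} {η : ℝ} (hη : 0 ≤ η)
    (hDD : ∀ y : V, |⟪y, e⟫_ℝ| ≤ η * Real.sqrt (‖u‖ ^ 2 - ‖T u‖ ^ 2) * Real.sqrt (‖y‖ ^ 2 - ‖adjoint T y‖ ^ 2)) :
    ⟪T u, e⟫_ℝ ≤ η * (‖u‖ ^ 2 - ‖T u‖ ^ 2) := by
  have h := hDD (T u)
  have hD : 0 ≤ ‖u‖ ^ 2 - ‖T u‖ ^ 2 := dissip_nonneg hT u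
  have h2 : Real.sqrt (‖T u‖ ^ 2 - ‖adjoint T (T u)‖ ^ 2) ≤ Real.sqrt (‖u‖ ^ 2 - ‖T u‖ ^ 2) :=
    Real.sqrt_le_sqrt (dissipAdj_apply_le_dissip T u)
  have hA : 0 ≤ η * Real.sqrt (‖u‖ ^ 2 - ‖T u‖ ^ 2) := mul_nonneg hη (Real.sqrt_nonneg _)
  calc ⟪T u, e⟫_ℝ ≤ |⟪T u, e⟫_ℝ| := le_abs_self _
    _ ≤ η * Real.sqrt (‖u‖ ^ 2 - ‖T u‖ ^ 2) * Real.sqrt (‖T u‖ ^ 2 - ‖adjoint T (T u)‖ ^ 2) := h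
    _ ≤ η * Real.sqrt (‖u‖ ^ 2 - ‖T u‖ ^ 2) * Real.sqrt (‖u‖ ^ 2 - ‖T u‖ ^ 2) := mul_le_mul_of_nonneg_left h2 hA
    _ = η * (‖u‖ ^ 2 - ‖T u‖ ^ 2) := by
      rw [mul_assoc, Real.mul_self_sqrt hD]

/-- ONE-WINDOW ENERGY BALANCE of the perturbed sequence: `(1 − 2η − η²)·(‖u‖² − ‖T u‖²) ≤ ‖u‖² − ‖T u + e‖²`. -/
theorem dissip_le_energy_drop {T : V →L[ℝ] V} (hT : ∀ x, ‖T x‖ ≤ ‖x‖) {u e : V} {η : ℝ} (hη : 0 ≤ η)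
    (hDD : ∀ y : V, |⟪y, e⟫_ℝ| ≤ η * Real.sqrt (‖u‖ ^ 2 - ‖T u‖ ^ 2) * Real.sqrt (‖y‖ ^ 2 - ‖adjoint T y‖ ^ 2)) :
    (1 - 2 * η - η ^ 2) * (‖u‖ ^ 2 - ‖T u‖ ^ 2) ≤ ‖u‖ ^ 2 - ‖T u + e‖ ^ 2 := by
  have hD : 0 ≤ ‖u‖ ^ 2 - ‖T u‖ ^ 2 := dissip_nonneg hT u
  have h1 : ‖T u + e‖ ^ 2 = ‖T u‖ ^ 2 + 2 * ⟪T u, e⟫_ℝ + ‖e‖ ^ 2 := norm_add_sq_real _ _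
  have h2 := inner_apply_err_le hT hη hDD
  have h3 := norm_err_le hη hDD
  have h4 : ‖e‖ ^ 2 ≤ η ^ 2 * (‖u‖ ^ 2 - ‖T u‖ ^ 2) := by
    have hA : 0 ≤ η * Real.sqrt (‖u‖ ^ 2 - ‖T u‖ ^ 2) := mul_nonneg hη (Real.sqrt_nonneg _)
    calc ‖e‖ ^ 2 ≤ (η * Real.sqrt (‖u‖ ^ 2 - ‖T u‖ ^ 2)) ^ 2 := pow_le_pow_left₀ (norm_nonneg _) h3 2
      _ = η ^ 2 * (‖u‖ ^ 2 - ‖T u‖ ^ 2) := by rw [mul_pow, Real.sq_sqrt hD]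
  nlinarith

/-- ONE-WINDOW BALANCE of the discrepancy `d`: `‖T d + e‖² ≤ ‖d‖² + 2η²·(‖u‖² − ‖T u‖²)` (the error's work on `T d` is absorbed by the
dissipation of `d`, AM–GM). -/
theorem norm_sq_apply_add_err_le {T : V →L[ℝ] V} (hT : ∀ x, ‖T x‖ ≤ ‖x‖) {u e : V} (d : V) {η : ℝ} (hη : 0 ≤ η)
    (hDD : ∀ y : V, |⟪y, e⟫_ℝ| ≤ η * Real.sqrt (‖u‖ ^ 2 - ‖T u‖ ^ 2) * Real.sqrt (‖y‖ ^ 2 - ‖adjoint T y‖ ^ 2)) :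
    ‖T d + e‖ ^ 2 ≤ ‖d‖ ^ 2 + 2 * η ^ 2 * (‖u‖ ^ 2 - ‖T u‖ ^ 2) := by
  have hD : 0 ≤ ‖u‖ ^ 2 - ‖T u‖ ^ 2 := dissip_nonneg hT u
  have hDd : 0 ≤ ‖d‖ ^ 2 - ‖T d‖ ^ 2 := dissip_nonneg hT d
  have h1 : ‖T d + e‖ ^ 2 = ‖T d‖ ^ 2 + 2 * ⟪T d, e⟫_ℝ + ‖e‖ ^ 2 := norm_add_sq_real _ _
  have h3 := norm_err_le hη hDD
  have h4 : ‖e‖ ^ 2 ≤ η ^ 2 * (‖u‖ ^ 2 - ‖T u‖ ^ 2) := by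
    have hA : 0 ≤ η * Real.sqrt (‖u‖ ^ 2 - ‖T u‖ ^ 2) := mul_nonneg hη (Real.sqrt_nonneg _)
    calc ‖e‖ ^ 2 ≤ (η * Real.sqrt (‖u‖ ^ 2 - ‖T u‖ ^ 2)) ^ 2 := pow_le_pow_left₀ (norm_nonneg _) h3 2
      _ = η ^ 2 * (‖u‖ ^ 2 - ‖T u‖ ^ 2) := by rw [mul_pow, Real.sq_sqrt hD]
  -- the cross term: `⟪T d, e⟫ ≤ η √D(u) √D(d)` and AM–GM
  have h5 : ⟪T d, e⟫_ℝ ≤ η * Real.sqrt (‖u‖ ^ 2 - ‖T u‖ ^ 2) * Real.sqrt (‖d‖ ^ 2 - ‖T d‖ ^ 2) := by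
    have h := hDD (T d)
    have h2 : Real.sqrt (‖T d‖ ^ 2 - ‖adjoint T (T d)‖ ^ 2) ≤ Real.sqrt (‖d‖ ^ 2 - ‖T d‖ ^ 2) :=
      Real.sqrt_le_sqrt (dissipAdj_apply_le_dissip T d)
    have hA : 0 ≤ η * Real.sqrt (‖u‖ ^ 2 - ‖T u‖ ^ 2) := mul_nonneg hη (Real.sqrt_nonneg _)
    calc ⟪T d, e⟫_ℝ ≤ |⟪T d, e⟫_ℝ| := le_abs_self _
      _ ≤ _ := h
      _ ≤ _ := mul_le_mul_of_nonneg_left h2 hA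
  have h6 : 2 * (η * Real.sqrt (‖u‖ ^ 2 - ‖T u‖ ^ 2) * Real.sqrt (‖d‖ ^ 2 - ‖T d‖ ^ 2)) ≤
      η ^ 2 * (‖u‖ ^ 2 - ‖T u‖ ^ 2) + (‖d‖ ^ 2 - ‖T d‖ ^ 2) := by
    have := two_mul_le_add_sq (η * Real.sqrt (‖u‖ ^ 2 - ‖T u‖ ^ 2)) (Real.sqrt (‖d‖ ^ 2 - ‖T d‖ ^ 2))
    rw [mul_pow, Real.sq_sqrt hD, Real.sq_sqrt hDd] at this
    linarith
  nlinarith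

/-! ## Cauchy–Schwarz in the form used to peel one window off the duality sum -/

/-- `√S √a + √D √b ≤ √(S+D) √(a+b)` for nonnegative reals (Cauchy–Schwarz in `ℝ²`). -/
theorem sqrt_mul_sqrt_add_le_sqrt_add_mul {S a D b : ℝ} (hS : 0 ≤ S) (ha : 0 ≤ a) (hD : 0 ≤ D) (hb : 0 ≤ b) :
    Real.sqrt S * Real.sqrt a + Real.sqrt D * Real.sqrt b ≤ Real.sqrt (S + D) * Real.sqrt (a + b) := by
  rw [← Real.sqrt_mul hS, ← Real.sqrt_mul hD, ← Real.sqrt_mul (by linarith)]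
  have hL : 0 ≤ Real.sqrt (S * a) + Real.sqrt (D * b) := by positivity
  rw [← Real.sqrt_sq hL]
  apply Real.sqrt_le_sqrt
  have h1 : (Real.sqrt (S * a) + Real.sqrt (D * b)) ^ 2 =
      S * a + D * b + 2 * (Real.sqrt (S * a) * Real.sqrt (D * b)) := by
    rw [add_sq, Real.sq_sqrt (by positivity), Real.sq_sqrt (by positivity)]; ring
  have h2 : Real.sqrt (S * a) * Real.sqrt (D * b) = Real.sqrt (S * b) * Real.sqrt (D * a) := by
    rw [← Real.sqrt_mul (by positivity), ← Real.sqrt_mul (by positivity)]; ring_nf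
  have h3 : 2 * (Real.sqrt (S * b) * Real.sqrt (D * a)) ≤ S * b + D * a := by
    have := two_mul_le_add_sq (Real.sqrt (S * b)) (Real.sqrt (D * a))
    rw [Real.sq_sqrt (by positivity), Real.sq_sqrt (by positivity)] at this
    linarith
  rw [h1, h2]
  nlinarith

/-! ## The window ledger -/

/-- **DUALITY SUM (inductive form).** For the perturbed sequence `u (k+1) = T k (u k) + e k` and the exact one
`v (k+1) = T k (v k)` with common start, and every `z`, there is a backward-propagated vector `b = (T 0)† ⋯ (T (K−1))† z` with
`‖b‖ ≤ ‖z‖`, `⟪b, x⟫ = ⟪z, T (K−1) ⋯ T 0 x⟫`-duality at `x = v 0`, and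
`|⟪z, u K − v K⟫| ≤ η · √(Σ_{k<K} (‖u k‖² − ‖T k (u k)‖²)) · √(‖z‖² − ‖b‖²)`. -/
theorem duality_sum (T : ℕ → V →L[ℝ] V) (hT : ∀ k x, ‖T k x‖ ≤ ‖x‖) (u v e : ℕ → V) (η : ℝ) (hη : 0 ≤ η)
    (h0 : u 0 = v 0) (hv : ∀ k, v (k + 1) = T k (v k)) (hu : ∀ k, u (k + 1) = T k (u k) + e k)
    (hDD : ∀ k, ∀ y : V, |⟪y, e k⟫_ℝ| ≤
      η * Real.sqrt (‖u k‖ ^ 2 - ‖T k (u k)‖ ^ 2) * Real.sqrt (‖y‖ ^ 2 - ‖adjoint (T k) y‖ ^ 2))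
    (K : ℕ) (z : V) :
    ∃ b : V, ‖b‖ ≤ ‖z‖ ∧ ⟪b, v 0⟫_ℝ = ⟪z, v K⟫_ℝ ∧
      |⟪z, u K - v K⟫_ℝ| ≤ η * Real.sqrt (∑ k ∈ Finset.range K, (‖u k‖ ^ 2 - ‖T k (u k)‖ ^ 2)) *
        Real.sqrt (‖z‖ ^ 2 - ‖b‖ ^ 2) := by
  induction K generalizing z with
  | zero =>
    refine ⟨z, le_rfl, rfl, ?_⟩
    simp [h0]
  | succ K ih =>
    obtain ⟨b, hb, hdual, hbound⟩ := ih (adjoint (T K) z)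
    have hTz : ‖adjoint (T K) z‖ ≤ ‖z‖ := norm_adjoint_apply_le_of_contraction (hT K) z
    refine ⟨b, hb.trans hTz, ?_, ?_⟩
    · rw [hdual, adjoint_inner_left, ← hv K]
    · -- peel the last window: `u (K+1) − v (K+1) = T K (u K − v K) + e K`
      have hsplit : ⟪z, u (K + 1) - v (K + 1)⟫_ℝ = ⟪adjoint (T K) z, u K - v K⟫_ℝ + ⟪z, e K⟫_ℝ := by
        rw [hu K, hv K, adjoint_inner_left, map_sub]
        rw [show T K (u K) + e K - T K (v K) = (T K (u K) - T K (v K)) + e K by abel, inner_add_right]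
      set S : ℝ := ∑ k ∈ Finset.range K, (‖u k‖ ^ 2 - ‖T k (u k)‖ ^ 2) with hS_def
      set D : ℝ := ‖u K‖ ^ 2 - ‖T K (u K)‖ ^ 2 with hD_def
      set a : ℝ := ‖adjoint (T K) z‖ ^ 2 - ‖b‖ ^ 2 with ha_def
      set c : ℝ := ‖z‖ ^ 2 - ‖adjoint (T K) z‖ ^ 2 with hc_def
      have hS : 0 ≤ S := Finset.sum_nonneg fun k _ => dissip_nonneg (hT k) (u k)
      have hD : 0 ≤ D := dissip_nonneg (hT K) (u K)
      have ha : 0 ≤ a := by rw [ha_def]; nlinarith [norm_nonneg b, norm_nonneg (adjoint (T K) z)]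
      have hc : 0 ≤ c := dissipAdj_nonneg (hT K) z
      have hsum : ∑ k ∈ Finset.range (K + 1), (‖u k‖ ^ 2 - ‖T k (u k)‖ ^ 2) = S + D := by
        rw [Finset.sum_range_succ]
      have hac : ‖z‖ ^ 2 - ‖b‖ ^ 2 = a + c := by rw [ha_def, hc_def]; ring
      rw [hsplit, hsum, hac]
      calc |⟪adjoint (T K) z, u K - v K⟫_ℝ + ⟪z, e K⟫_ℝ|
          ≤ |⟪adjoint (T K) z, u K - v K⟫_ℝ| + |⟪z, e K⟫_ℝ| := abs_add_le _ _
        _ ≤ η * Real.sqrt S * Real.sqrt a + η * Real.sqrt D * Real.sqrt c := add_le_add hbound (hDD K z)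
        _ = η * (Real.sqrt S * Real.sqrt a + Real.sqrt D * Real.sqrt c) := by ring
        _ ≤ η * (Real.sqrt (S + D) * Real.sqrt (a + c)) :=
          mul_le_mul_of_nonneg_left (sqrt_mul_sqrt_add_le_sqrt_add_mul hS ha hD hc) hη
        _ = η * Real.sqrt (S + D) * Real.sqrt (a + c) := by ring

/-- **ENERGY SUM.** The accumulated dissipation of the perturbed sequence is paid by its energy drop:
`(1 − 2η − η²) · Σ_{k<K} (‖u k‖² − ‖T k (u k)‖²) ≤ ‖u 0‖² − ‖u K‖²`. -/
theorem dissip_sum_le (T : ℕ → V →L[ℝ] V) (hT : ∀ k x, ‖T k x‖ ≤ ‖x‖) (u e : ℕ → V) (η : ℝ) (hη : 0 ≤ η)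
    (hu : ∀ k, u (k + 1) = T k (u k) + e k)
    (hDD : ∀ k, ∀ y : V, |⟪y, e k⟫_ℝ| ≤
      η * Real.sqrt (‖u k‖ ^ 2 - ‖T k (u k)‖ ^ 2) * Real.sqrt (‖y‖ ^ 2 - ‖adjoint (T k) y‖ ^ 2))
    (K : ℕ) :
    (1 - 2 * η - η ^ 2) * ∑ k ∈ Finset.range K, (‖u k‖ ^ 2 - ‖T k (u k)‖ ^ 2) ≤ ‖u 0‖ ^ 2 - ‖u K‖ ^ 2 := by
  induction K with
  | zero => simp
  | succ K ih =>
    rw [Finset.sum_range_succ, mul_add]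
    have hstep := dissip_le_energy_drop (hT K) hη (hDD K)
    rw [← hu K] at hstep
    linarith

/-- **DISCREPANCY SUM.** `‖u K − v K‖² ≤ 2η² · Σ_{k<K} (‖u k‖² − ‖T k (u k)‖²)`. -/
theorem norm_sq_sub_le (T : ℕ → V →L[ℝ] V) (hT : ∀ k x, ‖T k x‖ ≤ ‖x‖) (u v e : ℕ → V) (η : ℝ) (hη : 0 ≤ η)
    (h0 : u 0 = v 0) (hv : ∀ k, v (k + 1) = T k (v k)) (hu : ∀ k, u (k + 1) = T k (u k) + e k)
    (hDD : ∀ k, ∀ y : V, |⟪y, e k⟫_ℝ| ≤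
      η * Real.sqrt (‖u k‖ ^ 2 - ‖T k (u k)‖ ^ 2) * Real.sqrt (‖y‖ ^ 2 - ‖adjoint (T k) y‖ ^ 2))
    (K : ℕ) :
    ‖u K - v K‖ ^ 2 ≤ 2 * η ^ 2 * ∑ k ∈ Finset.range K, (‖u k‖ ^ 2 - ‖T k (u k)‖ ^ 2) := by
  induction K with
  | zero => simp [h0]
  | succ K ih =>
    rw [Finset.sum_range_succ, mul_add]
    have hrec : u (K + 1) - v (K + 1) = T K (u K - v K) + e K := by
      rw [hu K, hv K, map_sub]; abel
    rw [hrec]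
    have hstep := norm_sq_apply_add_err_le (hT K) (u K - v K) hη (hDD K)
    linarith

omit [CompleteSpace V] in
/-- The exact sequence of a contraction family does not grow: `‖v K‖ ≤ ‖v 0‖`. -/
theorem norm_exact_le (T : ℕ → V →L[ℝ] V) (hT : ∀ k x, ‖T k x‖ ≤ ‖x‖) (v : ℕ → V)
    (hv : ∀ k, v (k + 1) = T k (v k)) (K : ℕ) : ‖v K‖ ≤ ‖v 0‖ := by
  induction K with
  | zero => exact le_rfl
  | succ K ih =>
    have h : ‖v (K + 1)‖ ≤ ‖v K‖ := by rw [hv K]; exact hT K (v K)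
    exact h.trans ih

/-- **THE WINDOW LEDGER (dissipation-dominated errors ⇒ decay-relative energy excess).**  Let `T k` be linear contractions of a real
Hilbert space, `v (k+1) = T k (v k)` the exact sequence and `u (k+1) = T k (u k) + e k` a perturbed one from the same start `w₀ = u 0 = v 0`,
with every error dissipation-dominated: `|⟪y, e k⟫| ≤ η √(‖u k‖² − ‖T k (u k)‖²) √(‖y‖² − ‖(T k)† y‖²)` for all `y`, `0 ≤ η ≤ 1/8`.
Then for every `K`:  `‖u K‖² ≤ ‖v K‖² + 3η · (‖v 0‖² − ‖v K‖²)` — the energy excess of the perturbed sequence is at most `3η` times the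
energy the exact sequence has DROPPED, uniformly in the number of windows `K`. -/
theorem window_ledger (T : ℕ → V →L[ℝ] V) (hT : ∀ k x, ‖T k x‖ ≤ ‖x‖) (u v e : ℕ → V) (η : ℝ) (hη : 0 ≤ η) (hη8 : η ≤ 1 / 8)
    (h0 : u 0 = v 0) (hv : ∀ k, v (k + 1) = T k (v k)) (hu : ∀ k, u (k + 1) = T k (u k) + e k)
    (hDD : ∀ k, ∀ y : V, |⟪y, e k⟫_ℝ| ≤
      η * Real.sqrt (‖u k‖ ^ 2 - ‖T k (u k)‖ ^ 2) * Real.sqrt (‖y‖ ^ 2 - ‖adjoint (T k) y‖ ^ 2))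
    (K : ℕ) :
    ‖u K‖ ^ 2 ≤ ‖v K‖ ^ 2 + 3 * η * (‖v 0‖ ^ 2 - ‖v K‖ ^ 2) := by
  set S : ℝ := ∑ k ∈ Finset.range K, (‖u k‖ ^ 2 - ‖T k (u k)‖ ^ 2) with hS_def
  have hS : 0 ≤ S := Finset.sum_nonneg fun k _ => dissip_nonneg (hT k) (u k)
  -- the exact sequence is non-increasing in norm
  have hvK : ‖v K‖ ≤ ‖v 0‖ := norm_exact_le T hT v hv K
  have hdropv : 0 ≤ ‖v 0‖ ^ 2 - ‖v K‖ ^ 2 := by nlinarith [norm_nonneg (v K)]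
  -- duality at `z = v K`
  obtain ⟨b, hb, hdual, hbound⟩ := duality_sum T hT u v e η hη h0 hv hu hDD K (v K)
  -- `‖v K‖² − ‖b‖² ≤ drop_v`
  have hvv : ⟪b, v 0⟫_ℝ = ‖v K‖ ^ 2 := by rw [hdual, real_inner_self_eq_norm_sq]
  have hkey : ‖v K‖ ^ 2 - ‖b‖ ^ 2 ≤ ‖v 0‖ ^ 2 - ‖v K‖ ^ 2 := by
    have h1 : ‖v K‖ ^ 2 ≤ ‖b‖ * ‖v 0‖ := by rw [← hvv]; exact real_inner_le_norm _ _
    have h2 : (‖v K‖ ^ 2) ^ 2 ≤ ‖b‖ ^ 2 * ‖v 0‖ ^ 2 := by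
      calc (‖v K‖ ^ 2) ^ 2 ≤ (‖b‖ * ‖v 0‖) ^ 2 := pow_le_pow_left₀ (by positivity) h1 2
        _ = ‖b‖ ^ 2 * ‖v 0‖ ^ 2 := by ring
    -- `(‖v K‖² − ‖b‖²)·‖v 0‖² ≤ ‖v K‖²(‖v 0‖² − ‖v K‖²) ≤ ‖v 0‖²·(‖v 0‖² − ‖v K‖²)`
    by_cases h00 : ‖v 0‖ = 0
    · have : ‖v K‖ = 0 := le_antisymm (by rw [← h00]; exact hvK) (norm_nonneg _)
      rw [this, h00]; nlinarith [norm_nonneg b]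
    · have hpos : 0 < ‖v 0‖ ^ 2 := by positivity
      have h3 : (‖v K‖ ^ 2 - ‖b‖ ^ 2) * ‖v 0‖ ^ 2 ≤ (‖v 0‖ ^ 2 - ‖v K‖ ^ 2) * ‖v 0‖ ^ 2 := by
        nlinarith [norm_nonneg (v K), sq_nonneg (‖v 0‖ ^ 2 - ‖v K‖ ^ 2)]
      exact le_of_mul_le_mul_right h3 hpos
  have hcross : ⟪v K, u K - v K⟫_ℝ ≤ η * Real.sqrt S * Real.sqrt (‖v 0‖ ^ 2 - ‖v K‖ ^ 2) := by
    have hA : 0 ≤ η * Real.sqrt S := mul_nonneg hη (Real.sqrt_nonneg _)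
    calc ⟪v K, u K - v K⟫_ℝ ≤ |⟪v K, u K - v K⟫_ℝ| := le_abs_self _
      _ ≤ η * Real.sqrt S * Real.sqrt (‖v K‖ ^ 2 - ‖b‖ ^ 2) := hbound
      _ ≤ η * Real.sqrt S * Real.sqrt (‖v 0‖ ^ 2 - ‖v K‖ ^ 2) :=
        mul_le_mul_of_nonneg_left (Real.sqrt_le_sqrt hkey) hA
  -- AM–GM on the cross term: `2η √S √drop ≤ η (S + drop)`
  have hcross' : 2 * ⟪v K, u K - v K⟫_ℝ ≤ η * (S + (‖v 0‖ ^ 2 - ‖v K‖ ^ 2)) := by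
    have := two_mul_le_add_sq (Real.sqrt S) (Real.sqrt (‖v 0‖ ^ 2 - ‖v K‖ ^ 2))
    rw [Real.sq_sqrt hS, Real.sq_sqrt hdropv] at this
    nlinarith
  have hd := norm_sq_sub_le T hT u v e η hη h0 hv hu hDD K
  have hSu := dissip_sum_le T hT u e η hη hu hDD K
  -- `‖u K‖² = ‖v K‖² + 2⟪v K, d⟫ + ‖d‖²`
  have hexp : ‖u K‖ ^ 2 = ‖v K‖ ^ 2 + 2 * ⟪v K, u K - v K⟫_ℝ + ‖u K - v K‖ ^ 2 := by
    rw [← norm_add_sq_real, add_sub_cancel]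
  have hκ : (47 : ℝ) / 64 ≤ 1 - 2 * η - η ^ 2 := by nlinarith
  -- case split: if `‖u K‖² ≤ ‖v K‖²` there is nothing to prove
  by_cases hcase : ‖u K‖ ^ 2 ≤ ‖v K‖ ^ 2
  · nlinarith
  · -- otherwise `drop_u ≤ drop_v`, so `S ≤ drop_v / κ`
    have hdropu : ‖u 0‖ ^ 2 - ‖u K‖ ^ 2 ≤ ‖v 0‖ ^ 2 - ‖v K‖ ^ 2 := by rw [h0]; linarith
    have hS' : (47 : ℝ) / 64 * S ≤ ‖v 0‖ ^ 2 - ‖v K‖ ^ 2 := by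
      have : (47 : ℝ) / 64 * S ≤ (1 - 2 * η - η ^ 2) * S := mul_le_mul_of_nonneg_right hκ hS
      linarith
    nlinarith

end

end Summit.AnomalousDissipation.AnomalousDissipation.Theorems.SolenoidalFractalHomogenisation.LagrangianStep
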